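import Summits.AtomisticToContinuum.Crystallization.Theorems.OverbindingBudgetAffineFarFieldTaylor

/-!
# OverbindingBudget (2c) — part 27Va-B: the cell quadrature rule (lens-4 g93; r1659 «VORONOI-PIVOT-93» S1)

Support file, pure analysis on `ℝ³ = EuclideanSpace ℝ (Fin 3)`, no atlas.  THE TYPED INTERFACE of the
Voronoi far-field scheme (memo VORONOI-FF-g93 §1, §5 27Va) and its proof:

* `IsMomentCell K p σ δ μ₃ μ₄` — the moment data of a cell AS CONSUMED: `K` compact, star-shaped about
  `p ∈ K`, `0 ≤ δ`, centroid `∫_K (x − p) = 0`, second-moment form `|∫_K B(x−p, x−p) − σ|K| tr B|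
  ≤ δ|K|‖B‖` for every bilinear form `B`, `∫_K ‖x−p‖³ ≤ μ₃|K|`, `∫_K ‖x−p‖⁴ ≤ μ₄|K|`;
* `cell_taylor` — for `g ∈ C⁴(U)`, `U ⊇ K` open:
  `|∫_K g − |K|(g(p) + (σ/2)Δg(p))| ≤ |K|((δ/2)‖D²g(p)‖ + (μ₃/6)‖D³g(p)‖ + (μ₄/24) sup_K ‖D⁴g‖)`;
* `cell_taylor_symmetric` — on a centrally symmetric cell the cubic term drops (`integral_cubic_eq_zero`,
  reflection `x ↦ 2p − x` is measure preserving);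
* `secondMoment_form_of_coords` — the form clause from the nine coordinate moments
  `|∫_K (x−p)_i (x−p)_j − σ|K|δ_ij| ≤ δ₀|K|`, with `δ = 9δ₀` (how 27Vb feeds the interface).

`lap g p := Σ_i D²g(p)[e_i, e_i]` is the coordinate Laplacian; `e3 i` the standard basis.
-/

namespace Summit.AtomisticToContinuum.Crystallization.Theorems.OverbindingBudgetAffineFarFieldCellTaylor

open Set Filter
open scoped Topology Nat
open Summit.AtomisticToContinuum.Crystallization.Theorems.OverbindingBudgetAffineFarFieldTaylor

section Cell

open MeasureTheory

local notation "E3" => EuclideanSpace ℝ (Fin 3)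

/-- support: the standard basis vector `e i` of `ℝ³`. -/
noncomputable def e3 (i : Fin 3) : E3 := EuclideanSpace.single i (1 : ℝ)

/-- support: the coordinate Laplacian `Δg(p) = Σ_i D²g(p)[e_i, e_i]`. -/
noncomputable def lap (g : E3 → ℝ) (p : E3) : ℝ :=
  ∑ i : Fin 3, iteratedFDeriv ℝ 2 g p (fun _ => e3 i)

/-- support: the MOMENT DATA of a cell `K` about a point `p`, in the form the quadrature rule
consumes them — `K` compact and star-shaped about `p ∈ K`; `0 ≤ δ`; centroid `= p` (vector form);
second-moment form `= σ·vol·tr` up to `δ·vol·‖B‖` on every bilinear form `B`; third and fourth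
absolute moments `≤ μ₃·vol`, `≤ μ₄·vol`.  (27Vb supplies these for the distorted fcc/hcp cells.) -/
def IsMomentCell (K : Set E3) (p : E3) (σ δ μ₃ μ₄ : ℝ) : Prop :=
  IsCompact K ∧ StarConvex ℝ p K ∧ p ∈ K ∧ 0 ≤ δ ∧
  (∫ x in K, (x - p)) = 0 ∧
  (∀ B : E3 [×2]→L[ℝ] ℝ,
    |(∫ x in K, B (fun _ => x - p)) - σ * (volume K).toReal * ∑ i : Fin 3, B (fun _ => e3 i)|
      ≤ δ * (volume K).toReal * ‖B‖) ∧
  (∫ x in K, ‖x - p‖ ^ 3) ≤ μ₃ * (volume K).toReal ∧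
  (∫ x in K, ‖x - p‖ ^ 4) ≤ μ₄ * (volume K).toReal

/-- support: `K` is centrally symmetric about `p`. -/
def IsCentrallySymmetric (K : Set E3) (p : E3) : Prop := ∀ x ∈ K, (2 : ℝ) • p - x ∈ K

/-- Core estimate: the cell quadrature rule with an abstract bound `c₃` on the cubic term. -/
theorem cell_taylor_core {K U : Set E3} {p : E3} {σ δ μ₃ μ₄ : ℝ} (hK : IsMomentCell K p σ δ μ₃ μ₄)
    (hU : IsOpen U) (hKU : K ⊆ U) {g : E3 → ℝ} (hg : ContDiffOn ℝ 4 g U) {D₂ D₄ c₃ : ℝ}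
    (h2 : ‖iteratedFDeriv ℝ 2 g p‖ ≤ D₂)
    (h3 : |∫ x in K, iteratedFDeriv ℝ 3 g p (fun _ => x - p)| ≤ (volume K).toReal * c₃)
    (h4 : ∀ x ∈ K, ‖iteratedFDeriv ℝ 4 g x‖ ≤ D₄) :
    |(∫ x in K, g x) - (volume K).toReal * (g p + σ / 2 * lap g p)|
      ≤ (volume K).toReal * (δ / 2 * D₂ + c₃ / 6 + μ₄ / 24 * D₄) := by
  obtain ⟨hKc, hKs, hpK, hδ, hM1, hM2, hM3, hM4⟩ := hK
  have hKm : MeasurableSet K := hKc.measurableSet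
  set vol : ℝ := (volume K).toReal with hvol
  have hvol0 : 0 ≤ vol := ENNReal.toReal_nonneg
  set T₁ : E3 → ℝ := fun x => fderiv ℝ g p (x - p) with hT₁
  set T₂ : E3 → ℝ := fun x => iteratedFDeriv ℝ 2 g p (fun _ => x - p) with hT₂
  set T₃ : E3 → ℝ := fun x => iteratedFDeriv ℝ 3 g p (fun _ => x - p) with hT₃
  set R : E3 → ℝ := fun x => g x - (g p + T₁ x + T₂ x / 2 + T₃ x / 6) with hR
  -- pointwise remainder bound on `K`
  have hRb : ∀ x ∈ K, ‖R x‖ ≤ D₄ / 24 * ‖x - p‖ ^ 4 := by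
    intro x hx
    have hsegK : ∀ t ∈ Icc (0 : ℝ) 1, p + t • (x - p) ∈ K :=
      fun t ht => hKs.add_smul_sub_mem hx ht.1 ht.2
    have h := taylor_segment_three hU hg (fun t ht => hKU (hsegK t ht))
      (fun t ht => h4 _ (hsegK t ht))
    rw [Real.norm_eq_abs]
    simpa [hR, hT₁, hT₂, hT₃] using h
  -- continuity and integrability on `K`
  have hsubc : Continuous fun x : E3 => x - p := continuous_id.sub continuous_const
  have hgc : ContinuousOn g K := hg.continuousOn.mono hKU
  have hT₁c : Continuous T₁ := (fderiv ℝ g p).continuous.comp hsubc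
  have hT₂c : Continuous T₂ :=
    (iteratedFDeriv ℝ 2 g p).cont.comp (continuous_pi fun _ => hsubc)
  have hT₃c : Continuous T₃ :=
    (iteratedFDeriv ℝ 3 g p).cont.comp (continuous_pi fun _ => hsubc)
  have iG : IntegrableOn g K := hgc.integrableOn_compact hKc
  have iC : IntegrableOn (fun _ : E3 => g p) K := continuousOn_const.integrableOn_compact hKc
  have iT₁ : IntegrableOn T₁ K := hT₁c.continuousOn.integrableOn_compact hKc
  have iT₂ : IntegrableOn T₂ K := hT₂c.continuousOn.integrableOn_compact hKc
  have iT₃ : IntegrableOn T₃ K := hT₃c.continuousOn.integrableOn_compact hKc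
  have iS : IntegrableOn (fun x => g p + T₁ x + T₂ x / 2 + T₃ x / 6) K :=
    ((iC.add iT₁).add (iT₂.div_const 2)).add (iT₃.div_const 6)
  have iR : IntegrableOn R K := iG.sub iS
  have i4 : IntegrableOn (fun x : E3 => ‖x - p‖ ^ 4) K :=
    ((continuous_norm.comp hsubc).pow 4).continuousOn.integrableOn_compact hKc
  have iV : IntegrableOn (fun x : E3 => x - p) K := hsubc.continuousOn.integrableOn_compact hKc
  -- split the integral
  have hsplit : (∫ x in K, g x) = (∫ x in K, R x) + ((∫ x in K, (fun _ : E3 => g p) x)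
      + (∫ x in K, T₁ x) + (∫ x in K, T₂ x / 2) + (∫ x in K, T₃ x / 6)) := by
    have e0 : (∫ x in K, g x) = ∫ x in K, (R x + (g p + T₁ x + T₂ x / 2 + T₃ x / 6)) := by
      congr 1; funext x; simp only [hR]; ring
    have iCT : Integrable (fun x => g p + T₁ x) (volume.restrict K) := iC.add iT₁
    have iCT2 : Integrable (fun x => g p + T₁ x + T₂ x / 2) (volume.restrict K) :=
      iCT.add (iT₂.div_const 2)
    have a1 : (∫ x in K, (g p + T₁ x + T₂ x / 2 + T₃ x / 6))
        = (∫ x in K, (g p + T₁ x + T₂ x / 2)) + ∫ x in K, T₃ x / 6 :=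
      integral_add iCT2 (iT₃.div_const 6)
    have a2 : (∫ x in K, (g p + T₁ x + T₂ x / 2))
        = (∫ x in K, (g p + T₁ x)) + ∫ x in K, T₂ x / 2 := integral_add iCT (iT₂.div_const 2)
    have a3 : (∫ x in K, (g p + T₁ x)) = (∫ x in K, (fun _ : E3 => g p) x) + ∫ x in K, T₁ x :=
      integral_add iC iT₁
    rw [e0, integral_add iR iS, a1, a2, a3]
  -- the pieces
  have vC : (∫ x in K, (fun _ : E3 => g p) x) = vol * g p := by
    simp [measureReal_def, hvol]
  have vT₁ : (∫ x in K, T₁ x) = 0 := by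
    have h := (fderiv ℝ g p).integral_comp_comm (μ := volume.restrict K) iV
    simp only [hT₁]
    rw [h, hM1, map_zero]
  have vT₂ : |(∫ x in K, T₂ x) - σ * vol * lap g p| ≤ δ * vol * D₂ := by
    have h := hM2 (iteratedFDeriv ℝ 2 g p)
    have h' : δ * vol * ‖iteratedFDeriv ℝ 2 g p‖ ≤ δ * vol * D₂ := by
      have : 0 ≤ δ * vol := mul_nonneg hδ hvol0
      exact mul_le_mul_of_nonneg_left h2 this
    simpa [hT₂, lap] using h.trans h'
  have vR : |∫ x in K, R x| ≤ vol * (μ₄ / 24 * D₄) := by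
    have hD₄ : 0 ≤ D₄ := (norm_nonneg _).trans (h4 p hpK)
    have h1 : ‖∫ x in K, R x‖ ≤ ∫ x in K, D₄ / 24 * ‖x - p‖ ^ 4 :=
      norm_integral_le_of_norm_le (i4.const_mul (D₄ / 24)) (ae_restrict_of_forall_mem hKm hRb)
    rw [integral_const_mul, Real.norm_eq_abs] at h1
    calc |∫ x in K, R x| ≤ D₄ / 24 * ∫ x in K, ‖x - p‖ ^ 4 := h1
      _ ≤ D₄ / 24 * (μ₄ * vol) := by gcongr
      _ = vol * (μ₄ / 24 * D₄) := by ring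
  have e2 : (∫ x in K, T₂ x / 2) = (∫ x in K, T₂ x) / 2 := integral_div 2 T₂
  have e3' : (∫ x in K, T₃ x / 6) = (∫ x in K, T₃ x) / 6 := integral_div 6 T₃
  have key : (∫ x in K, g x) - vol * (g p + σ / 2 * lap g p)
      = (∫ x in K, R x) + ((∫ x in K, T₂ x) - σ * vol * lap g p) / 2
        + (∫ x in K, T₃ x) / 6 := by
    rw [hsplit, vC, vT₁, e2, e3']; ring
  rw [key]
  have h3' : |∫ x in K, T₃ x| ≤ vol * c₃ := by simpa [hT₃] using h3
  calc |(∫ x in K, R x) + ((∫ x in K, T₂ x) - σ * vol * lap g p) / 2 + (∫ x in K, T₃ x) / 6|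
      ≤ |∫ x in K, R x| + |((∫ x in K, T₂ x) - σ * vol * lap g p) / 2|
          + |(∫ x in K, T₃ x) / 6| :=
        by
          have t1 := abs_add_le ((∫ x in K, R x) + ((∫ x in K, T₂ x) - σ * vol * lap g p) / 2)
            ((∫ x in K, T₃ x) / 6)
          have t2 := abs_add_le (∫ x in K, R x) (((∫ x in K, T₂ x) - σ * vol * lap g p) / 2)
          linarith
    _ = |∫ x in K, R x| + |(∫ x in K, T₂ x) - σ * vol * lap g p| / 2
          + |∫ x in K, T₃ x| / 6 := by
        rw [abs_div, abs_div, abs_of_pos (by norm_num : (0:ℝ) < 2),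
          abs_of_pos (by norm_num : (0:ℝ) < 6)]
    _ ≤ vol * (μ₄ / 24 * D₄) + (δ * vol * D₂) / 2 + (vol * c₃) / 6 := by
        gcongr
    _ = vol * (δ / 2 * D₂ + c₃ / 6 + μ₄ / 24 * D₄) := by ring

/-- **Cell quadrature rule (general cell).**
`|∫_K g − |K|·(g(p) + (σ/2)Δg(p))| ≤ |K|·((δ/2)‖D²g(p)‖ + (μ₃/6)‖D³g(p)‖ + (μ₄/24) sup_K ‖D⁴g‖)`. -/
theorem cell_taylor {K U : Set E3} {p : E3} {σ δ μ₃ μ₄ : ℝ} (hK : IsMomentCell K p σ δ μ₃ μ₄)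
    (hU : IsOpen U) (hKU : K ⊆ U) {g : E3 → ℝ} (hg : ContDiffOn ℝ 4 g U) {D₂ D₃ D₄ : ℝ}
    (h2 : ‖iteratedFDeriv ℝ 2 g p‖ ≤ D₂) (h3 : ‖iteratedFDeriv ℝ 3 g p‖ ≤ D₃)
    (h4 : ∀ x ∈ K, ‖iteratedFDeriv ℝ 4 g x‖ ≤ D₄) :
    |(∫ x in K, g x) - (volume K).toReal * (g p + σ / 2 * lap g p)|
      ≤ (volume K).toReal * (δ / 2 * D₂ + μ₃ / 6 * D₃ + μ₄ / 24 * D₄) := by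
  have hK' := hK
  obtain ⟨hKc, hKs, hpK, hδ, hM1, hM2, hM3, hM4⟩ := hK'
  have hKm : MeasurableSet K := hKc.measurableSet
  have hsubc : Continuous fun x : E3 => x - p := continuous_id.sub continuous_const
  have i3 : IntegrableOn (fun x : E3 => ‖x - p‖ ^ 3) K :=
    ((continuous_norm.comp hsubc).pow 3).continuousOn.integrableOn_compact hKc
  have hD₃ : 0 ≤ D₃ := (norm_nonneg _).trans h3
  have hpt : ∀ x ∈ K, ‖iteratedFDeriv ℝ 3 g p (fun _ => x - p)‖ ≤ D₃ * ‖x - p‖ ^ 3 := by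
    intro x _
    have h := (iteratedFDeriv ℝ 3 g p).le_opNorm (fun _ => x - p)
    simp only [Finset.prod_const, Finset.card_univ, Fintype.card_fin] at h
    exact h.trans (by gcongr)
  have h1 : ‖∫ x in K, iteratedFDeriv ℝ 3 g p (fun _ => x - p)‖ ≤ ∫ x in K, D₃ * ‖x - p‖ ^ 3 :=
    norm_integral_le_of_norm_le (i3.const_mul D₃) (ae_restrict_of_forall_mem hKm hpt)
  rw [integral_const_mul, Real.norm_eq_abs] at h1
  have h3' : |∫ x in K, iteratedFDeriv ℝ 3 g p (fun _ => x - p)|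
      ≤ (volume K).toReal * (μ₃ * D₃) :=
    calc _ ≤ D₃ * ∫ x in K, ‖x - p‖ ^ 3 := h1
      _ ≤ D₃ * (μ₃ * (volume K).toReal) := by gcongr
      _ = (volume K).toReal * (μ₃ * D₃) := by ring
  have h := cell_taylor_core hK hU hKU hg h2 h3' h4
  calc _ ≤ (volume K).toReal * (δ / 2 * D₂ + μ₃ * D₃ / 6 + μ₄ / 24 * D₄) := h
    _ = (volume K).toReal * (δ / 2 * D₂ + μ₃ / 6 * D₃ + μ₄ / 24 * D₄) := by ring

/-- Structured cubic clause (cells WITHOUT an inversion centre, e.g. the `h`-letter cell, whose third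
moment tensor has one small `D3h` component): if every cubic form integrates over `K` to at most
`τ·|K|·‖B‖`, the cubic error term is `τ/6·D₃` (instead of the crude `μ₃/6·D₃` of `cell_taylor`). -/
theorem cell_taylor_tau {K U : Set E3} {p : E3} {σ δ μ₃ μ₄ τ : ℝ} (hK : IsMomentCell K p σ δ μ₃ μ₄)
    (hτ0 : 0 ≤ τ)
    (hτ : ∀ B : E3 [×3]→L[ℝ] ℝ, |∫ x in K, B (fun _ => x - p)| ≤ τ * (volume K).toReal * ‖B‖)
    (hU : IsOpen U) (hKU : K ⊆ U) {g : E3 → ℝ} (hg : ContDiffOn ℝ 4 g U) {D₂ D₃ D₄ : ℝ}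
    (h2 : ‖iteratedFDeriv ℝ 2 g p‖ ≤ D₂) (h3 : ‖iteratedFDeriv ℝ 3 g p‖ ≤ D₃)
    (h4 : ∀ x ∈ K, ‖iteratedFDeriv ℝ 4 g x‖ ≤ D₄) :
    |(∫ x in K, g x) - (volume K).toReal * (g p + σ / 2 * lap g p)|
      ≤ (volume K).toReal * (δ / 2 * D₂ + τ / 6 * D₃ + μ₄ / 24 * D₄) := by
  have hτv : 0 ≤ τ * (volume K).toReal := mul_nonneg hτ0 ENNReal.toReal_nonneg
  have h3' : |∫ x in K, iteratedFDeriv ℝ 3 g p (fun _ => x - p)|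
      ≤ (volume K).toReal * (τ * D₃) :=
    calc _ ≤ τ * (volume K).toReal * ‖iteratedFDeriv ℝ 3 g p‖ := hτ _
      _ ≤ τ * (volume K).toReal * D₃ := mul_le_mul_of_nonneg_left h3 hτv
      _ = (volume K).toReal * (τ * D₃) := by ring
  have h := cell_taylor_core hK hU hKU hg h2 h3' h4
  calc _ ≤ (volume K).toReal * (δ / 2 * D₂ + τ * D₃ / 6 + μ₄ / 24 * D₄) := h
    _ = (volume K).toReal * (δ / 2 * D₂ + τ / 6 * D₃ + μ₄ / 24 * D₄) := by ring

/-- On a centrally symmetric cell every odd (here: cubic) form integrates to zero. -/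
theorem integral_cubic_eq_zero {K : Set E3} {p : E3} (hS : IsCentrallySymmetric K p)
    (B : E3 [×3]→L[ℝ] ℝ) : ∫ x in K, B (fun _ => x - p) = 0 := by
  set r : E3 → E3 := fun x => (2 : ℝ) • p - x with hr
  have hmp : MeasurePreserving r volume volume :=
    Measure.measurePreserving_sub_left volume ((2 : ℝ) • p)
  have hme : MeasurableEmbedding r := measurableEmbedding_subLeft ((2 : ℝ) • p)
  have hrr : ∀ x, r (r x) = x := by intro x; simp [hr]
  have hrK : r ⁻¹' K = K := by
    ext x
    constructor
    · intro hx
      have h := hS _ hx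
      rwa [show (2 : ℝ) • p - r x = x from hrr x] at h
    · intro hx
      exact hS x hx
  have h := hmp.setIntegral_preimage_emb hme (fun y => B (fun _ => y - p)) K
  rw [hrK] at h
  have hodd : ∀ x, B (fun _ => r x - p) = -B (fun _ => x - p) := by
    intro x
    have e : (fun _ : Fin 3 => r x - p) = fun _ => (-1 : ℝ) • (x - p) := by
      funext; simp only [hr, two_smul, neg_smul, one_smul]; abel
    rw [e, B.map_smul_univ]
    norm_num
  simp_rw [hodd, integral_neg] at h
  linarith

/-- **Cell quadrature rule (centrally symmetric cell)**: the cubic term drops out. -/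
theorem cell_taylor_symmetric {K U : Set E3} {p : E3} {σ δ μ₃ μ₄ : ℝ}
    (hK : IsMomentCell K p σ δ μ₃ μ₄) (hS : IsCentrallySymmetric K p)
    (hU : IsOpen U) (hKU : K ⊆ U) {g : E3 → ℝ} (hg : ContDiffOn ℝ 4 g U) {D₂ D₄ : ℝ}
    (h2 : ‖iteratedFDeriv ℝ 2 g p‖ ≤ D₂) (h4 : ∀ x ∈ K, ‖iteratedFDeriv ℝ 4 g x‖ ≤ D₄) :
    |(∫ x in K, g x) - (volume K).toReal * (g p + σ / 2 * lap g p)|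
      ≤ (volume K).toReal * (δ / 2 * D₂ + μ₄ / 24 * D₄) := by
  have h3' : |∫ x in K, iteratedFDeriv ℝ 3 g p (fun _ => x - p)| ≤ (volume K).toReal * 0 := by
    rw [integral_cubic_eq_zero hS]; simp
  have h := cell_taylor_core hK hU hKU hg h2 h3' h4
  simpa using h


/-! ### From coordinate moments to the form hypothesis of `IsMomentCell` -/

/-- `expand_e3` (docstring added by the landing lane; see the module docstring). [formal bookkeeping] -/
theorem expand_e3 (w : E3) : w = ∑ i : Fin 3, w i • e3 i := by
  have h := (EuclideanSpace.basisFun (Fin 3) ℝ).sum_repr w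
  simp only [EuclideanSpace.basisFun_repr, EuclideanSpace.basisFun_apply] at h
  simpa [e3] using h.symm

/-- Linearity in one slot of a bilinear form, expanded in the basis `e3`. -/
theorem slot_expand (B : E3 [×2]→L[ℝ] ℝ) (m : Fin 2 → E3) (k : Fin 2) (w : E3) :
    B (Function.update m k w) = ∑ j : Fin 3, w j * B (Function.update m k (e3 j)) := by
  have hL : ∀ v : E3, B (Function.update m k v) = B.toContinuousLinearMap m k v := fun v => rfl
  rw [hL]
  conv_lhs => rw [expand_e3 w]
  rw [map_sum]
  refine Finset.sum_congr rfl (fun j _ => ?_)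
  rw [map_smul, smul_eq_mul, hL]

/-- A bilinear form on the diagonal, expanded in coordinates. -/
theorem two_form_expand (B : E3 [×2]→L[ℝ] ℝ) (w : E3) :
    B (fun _ => w) = ∑ i : Fin 3, ∑ j : Fin 3, (w i * w j) * B ![e3 i, e3 j] := by
  have t0 : (fun _ : Fin 2 => w) = Function.update ![w, w] 0 w := by
    funext k; fin_cases k <;> simp
  rw [t0, slot_expand]
  refine Finset.sum_congr rfl (fun i _ => ?_)
  have t1 : Function.update ![w, w] 0 (e3 i) = Function.update ![e3 i, w] 1 w := by
    funext k; fin_cases k <;> simp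
  rw [t1, slot_expand, Finset.mul_sum]
  refine Finset.sum_congr rfl (fun j _ => ?_)
  have t2 : Function.update ![e3 i, w] 1 (e3 j) = ![e3 i, e3 j] := by
    funext k; fin_cases k <;> simp
  rw [t2]
  ring

/-- `two_form_diag` (docstring added by the landing lane; see the module docstring). [formal bookkeeping] -/
theorem two_form_diag (B : E3 [×2]→L[ℝ] ℝ) (i : Fin 3) : B (fun _ => e3 i) = B ![e3 i, e3 i] := by
  congr 1
  funext k; fin_cases k <;> simp

/-- `norm_e3` (docstring added by the landing lane; see the module docstring). [formal bookkeeping] -/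
theorem norm_e3 (i : Fin 3) : ‖e3 i‖ = 1 := by
  simp [e3]

/-- `abs_two_form_e3_le` (docstring added by the landing lane; see the module docstring). [formal bookkeeping] -/
theorem abs_two_form_e3_le (B : E3 [×2]→L[ℝ] ℝ) (i j : Fin 3) : |B ![e3 i, e3 j]| ≤ ‖B‖ := by
  have h := B.le_opNorm ![e3 i, e3 j]
  rw [Fin.prod_univ_two] at h
  simp only [Matrix.cons_val_zero, Matrix.cons_val_one, norm_e3, mul_one] at h
  rwa [Real.norm_eq_abs] at h

/-- support: COORDINATE MOMENTS ⇒ FORM HYPOTHESIS.  If the nine second moments of `K` about `p`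
are `σ·|K|·δ_ij` up to `δ₀·|K|`, then the form clause of `IsMomentCell` holds with `δ = 9 δ₀`. -/
theorem secondMoment_form_of_coords {K : Set E3} {p : E3} (hKc : IsCompact K) {σ δ₀ : ℝ}
    (hm : ∀ i j : Fin 3, |(∫ x in K, (x - p) i * (x - p) j)
        - σ * (volume K).toReal * (if i = j then 1 else 0)| ≤ δ₀ * (volume K).toReal)
    (B : E3 [×2]→L[ℝ] ℝ) :
    |(∫ x in K, B (fun _ => x - p)) - σ * (volume K).toReal * ∑ i : Fin 3, B (fun _ => e3 i)|
      ≤ 9 * δ₀ * (volume K).toReal * ‖B‖ := by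
  set vol := (volume K).toReal with hvol
  have hsubc : Continuous fun x : E3 => x - p := continuous_id.sub continuous_const
  have hci : ∀ i : Fin 3, Continuous fun x : E3 => (x - p) i :=
    fun i => (EuclideanSpace.proj i).continuous.comp hsubc
  have hint : ∀ i j : Fin 3,
      IntegrableOn (fun x : E3 => (x - p) i * (x - p) j * B ![e3 i, e3 j]) K := fun i j =>
    (((hci i).mul (hci j)).mul continuous_const).continuousOn.integrableOn_compact hKc
  -- expand the integrand and swap integral and sums
  have h1 : (∫ x in K, B (fun _ => x - p))
      = ∑ i : Fin 3, ∑ j : Fin 3, (∫ x in K, (x - p) i * (x - p) j) * B ![e3 i, e3 j] := by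
    have e : (fun x : E3 => B (fun _ => x - p))
        = fun x => ∑ i : Fin 3, ∑ j : Fin 3, (x - p) i * (x - p) j * B ![e3 i, e3 j] := by
      funext x; exact two_form_expand B (x - p)
    rw [e, integral_finsetSum _ (fun i _ => integrable_finsetSum _ (fun j _ => hint i j))]
    refine Finset.sum_congr rfl (fun i _ => ?_)
    rw [integral_finsetSum _ (fun j _ => hint i j)]
    refine Finset.sum_congr rfl (fun j _ => ?_)
    rw [integral_mul_const]
  have h2 : σ * vol * ∑ i : Fin 3, B (fun _ => e3 i)
      = ∑ i : Fin 3, ∑ j : Fin 3, (σ * vol * (if i = j then 1 else 0)) * B ![e3 i, e3 j] := by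
    rw [Finset.mul_sum]
    refine Finset.sum_congr rfl (fun i _ => ?_)
    rw [two_form_diag]
    simp [Finset.sum_ite_eq, mul_assoc]
  rw [h1, h2, ← Finset.sum_sub_distrib]
  simp_rw [← Finset.sum_sub_distrib, ← sub_mul]
  calc |∑ i : Fin 3, ∑ j : Fin 3, ((∫ x in K, (x - p) i * (x - p) j)
          - σ * vol * (if i = j then 1 else 0)) * B ![e3 i, e3 j]|
      ≤ ∑ i : Fin 3, ∑ j : Fin 3, |((∫ x in K, (x - p) i * (x - p) j)
          - σ * vol * (if i = j then 1 else 0)) * B ![e3 i, e3 j]| := by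
        refine (Finset.abs_sum_le_sum_abs _ _).trans (Finset.sum_le_sum (fun i _ => ?_))
        exact Finset.abs_sum_le_sum_abs _ _
    _ ≤ ∑ i : Fin 3, ∑ j : Fin 3, δ₀ * vol * ‖B‖ := by
        refine Finset.sum_le_sum (fun i _ => Finset.sum_le_sum (fun j _ => ?_))
        rw [abs_mul]
        have ha := hm i j
        have hb := abs_two_form_e3_le B i j
        have h0 : 0 ≤ δ₀ * vol := le_trans (abs_nonneg _) ha
        calc _ ≤ (δ₀ * vol) * ‖B‖ := mul_le_mul ha hb (abs_nonneg _) h0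
          _ = δ₀ * vol * ‖B‖ := rfl
    _ = 9 * δ₀ * vol * ‖B‖ := by
        simp only [Finset.sum_const, Finset.card_univ, Fintype.card_fin]
        ring

end Cell

end Summit.AtomisticToContinuum.Crystallization.Theorems.OverbindingBudgetAffineFarFieldCellTaylor
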